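import Mathlib
import HarnessLib
import Summits.HubbardSuperconductivity.HubbardSuperconductivity.Theorems.KLProgrammeKLRegimeSplitGlueP4
import Summits.HubbardSuperconductivity.HubbardSuperconductivity.Theorems.KLProgrammeKLRegimeVolumeLimitExDefs
import Summits.HubbardSuperconductivity.HubbardSuperconductivity.Theorems.KLProgrammeKLRegimeSplitSlotsV17F

/-!
# Route `KLProgramme` — crux K3 `KLRegimeTwoPointLimit` (stmt-HubbardSuperconductivity-19937): the GEN-7-FLOW CHILDREN TEXTS and the GLUE at `klPredsV17F`
# (plan g16 K3-FLOW RULING F, KL STATUS 2026-08-27 l.2548, step S2; seat hubbard-kl-k3c3-p2 (+ p2 g10, whose draft §8 this file is, verbatim up to names))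

The five children of the re-split onto the flowing-dispersion bundle `klPredsV17F` (`…SplitSlotsV17F`: dummy frame `K = 0`, flow frame `klFlowFrameU … n`
read inside every slot) and the K3-named glue, in the shape the pen's `--resplit … --glue 'KLRegimeTwoPointLimit_of_V17F'` verb and gen 6's precedent
(`…SplitGlueV16P4Ex` / glue item 20241) expect:
* the children TEXTS are the generics BY NAME (no new definitions; kernel lane): child 3-F `KLRegimeEngineV17F := EngineP4 klPredsV17F klWindowC`,
  child 1-F `KLRegimeBetaSplitV17F := BetaSplitP klPredsV17F klWindowC`, child 2-F `KLRegimeRenormFlowV17F := CountertermP2 klPredsV17F klWindowC` (the FORWARD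
  induction: renorm-history ⇒ engine ∧ twoLeg ∧ split at `n` ⇒ `RenormFlowAtV17F` at every `n ≤ n_β`, dummy `K := 0`; proved in `…RenormFlowV17F`),
  child 5-F `KLRegimeVolumeLimitV17F := VolumeLimitP2 klPredsV17F FinalTwoLegVolLimitEx klWindowC`, child 4-F `KLRegimeTwoPointAssemblyV17F :=
  TwoPointAssemblyP3 klPredsV17F FinalTwoLegVolLimitEx klWindowC` — in this ORDER in the glue's binders (Engine, BetaSplit, RenormFlow, VolumeLimit, TwoPointAssembly);
* **`KLRegimeTwoPointLimit_of_V17F`**: the five texts imply `…Theses.KLProgramme.KLRegimeTwoPointLimit` BY NAME — `KLRegimeInductionP4 klPredsV17F FinalTwoLegVolLimitEx`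
  VERBATIM (the generic machinery hosts the flow scheme without edit, PF-0);
* AT-BIRTH closers that need no engine: **`twoPointAssemblyP3_klPredsV17F`** (child 4-F; `twoPointAssemblyP3_ex` is `Pr`-universal — K3-FLOW-PRICING Q-F2 (i)),
  `klPredsV17F_frameOK_zeroC` ((R6-3): the bare frame is the dummy class's point, `klFrameOK_zeroC`).
Nothing here asserts superconductivity; no engine stub is proved here.
-/

noncomputable section

namespace Summit.HubbardSuperconductivity.HubbardSuperconductivity.Theorems.KLRegimeSplit

set_option linter.dupNamespace false -- summit = problem name (single-conjunct summit), D-0017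

/-- **THE K3-NAMED GLUE AT `klPredsV17F`** (`KLRegimeInductionP4` VERBATIM): the five gen-7-flow children imply crux K3 `KLRegimeTwoPointLimit` BY NAME. -/
theorem KLRegimeTwoPointLimit_of_V17F :
    EngineP4 klPredsV17F klWindowC → BetaSplitP klPredsV17F klWindowC → CountertermP2 klPredsV17F klWindowC →
      VolumeLimitP2 klPredsV17F FinalTwoLegVolLimitEx klWindowC → TwoPointAssemblyP3 klPredsV17F FinalTwoLegVolLimitEx klWindowC →
        Summit.HubbardSuperconductivity.HubbardSuperconductivity.Theses.KLProgramme.KLRegimeTwoPointLimit :=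
  KLRegimeInductionP4 klPredsV17F FinalTwoLegVolLimitEx

/-- **Child 4-F closes AT BIRTH**: `TwoPointAssemblyP3 klPredsV17F FinalTwoLegVolLimitEx klWindowC` — `twoPointAssemblyP3_ex` is `Pr`-universal (reads only the
volume-limit slot). -/
theorem twoPointAssemblyP3_klPredsV17F : TwoPointAssemblyP3 klPredsV17F FinalTwoLegVolLimitEx klWindowC :=
  twoPointAssemblyP3_ex klPredsV17F klWindowC

/-- **(R6-3) at V17F**: the bare frame is (the only point of) the dummy frame class, on the covariance window (`klFrameOK_zeroC`). -/
theorem klPredsV17F_frameOK_zeroC {R : RenConsts} (hR : R.WF) (U : ℝ) (N : ℕ) {μ : ℝ} (hμ : μ ∈ klWindowC) : klPredsV17F.frameOK R U N μ 0 :=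
  ⟨rfl, klFrameOK_zeroC hR U N hμ⟩

end Summit.HubbardSuperconductivity.HubbardSuperconductivity.Theorems.KLRegimeSplit

end
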